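import Mathlib
import Summits.ValiantsHypothesis.ValiantsHypothesis.Theorems.UlrichPaddedPermHypersurfaceFactorial
import Literature.Computability.AlgebraicComplexity.PermanentIrreducible
import Literature.Computability.AlgebraicComplexity.StandardFamiliesProofs
import Literature.RingTheory.RegularLocalRing.GradedFactorialProofs

/-!
# Crux `DivisionGap.PerCofactorDegreeReduction` (stmt-ValiantsHypothesis-15046), line `Sketch` —
# stub `stub_twoTowerCollapse`: collapse of a two-tower relation modulo the permanent

**Theorem (`stub_twoTowerCollapse`).** Let `n ≥ 3`, let `V₁, V₂, u, u' ∈ ℝ≥0[x_ij]` (`n × n`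
variables) with `Vᵢ ≠ 0` homogeneous of degree `dᵢ < N`, and suppose
`per_n ∣ V₁ u^N + V₂ u'^N` over `ℝ`.  Then over `ℝ` one of: `per_n ∣ u`; `per_n ∣ u'`;
`per_n ∣ c V₁ + V₂` for some real `c > 0`; `per_n ∣ u + c u'` for some real `c > 0`.

## Proof

Work in `S = ℂ[x]/(per_n)`, a domain and a UFD for `n ≥ 3` (tree theorem
`Summit.ValiantsHypothesis.Theorems.permQuot_isDomain_and_ufm`), graded by total degree
(`(per_n)` is homogeneous; `Literature.RingTheory.GradedAlgebra.quotGrading`) with degree-`0` part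
`ℂ`.  Bars denote images in `S`; the hypothesis reads `V̄₁ ū^N + V̄₂ ū'^N = 0`.
* §1 *Descent.* For real `q, r`: `q ∣ r` over `ℂ` implies `q ∣ r` over `ℝ` (take real parts of
  the coefficients of the cofactor), and `q ∣ r − c r'` over `ℂ` with `c ∉ ℝ` implies `q ∣ r'`
  (take imaginary parts).  So `ū = 0` / `ū' = 0` give the first two disjuncts, and `V̄₁ = 0`
  forces `V̄₂ = 0` (domain), the third disjunct with `c = 1`.
* §2 *Graded UFD.* In an `ℕ`-graded domain whose nonzero degree-`0` elements are units: units are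
  homogeneous of degree `0` (`x y = 1` is homogeneous, so `x`, `y` are, and degrees add to `0`);
  if `π^k ∣ x` with `π` prime and `x ≠ 0` homogeneous of degree `d` then `k ≤ d` (`π` and the
  cofactor are homogeneous as divisors of a homogeneous element —
  `Literature.RingTheory.RegularLocalRing.isHomogeneousElem_of_mul_mem` — `deg π ≥ 1` since `π`
  is not a unit, and `k · deg π ≤ d`).  Hence every prime has multiplicity `≤ dᵢ < N` in `V̄ᵢ`,
  and counting prime factors in `V̄₁ ū^N = −V̄₂ ū'^N` (all four nonzero) gives, prime by prime,
  `a + N x = b + N y` with `a, b < N`, so `x = y`: `ū`, `ū'` have the same factorisation and are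
  associated, `ū = ε ū'` with `ε` a unit, i.e. `ε = c̄` for a constant `c ∈ ℂˣ`.
* §3 *Conclusion.* `c ∈ ℝ` by §1 (else `per_n ∣ u'`).  If `c < 0`: `ū + |c| ū' = 0`, fourth
  disjunct.  If `c > 0`: `(c^N V̄₁ + V̄₂) ū'^N = 0` and `ū' ≠ 0` give `c^N V̄₁ + V̄₂ = 0`, third
  disjunct with `c^N`.
The hypotheses `Vᵢ ≠ 0` and the homogeneity of `u`, `u'` in the registered signature are not
needed (only `V̄ᵢ`, `ū`, `ū'` matter, and their vanishing is a disjunct).  Design: no definitions;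
real/imaginary parts of coefficients are Mathlib's `AddMonoidAlgebra.map` of
`Complex.reAddGroupHom` / `Complex.imAddGroupHom`; §2 is stated for gradings by additive
subgroups (the tree's `GradedFactorialProofs` toolkit) and transported to the quotient grading by
submodules by re-bundling, as in `PermHypersurfaceFactorial.permQuot_ufm_of_gradedAlgebra`.
-/

noncomputable section

-- `Summit.ValiantsHypothesis.ValiantsHypothesis.…` is the tree's mandated single-conjunct layout
-- (Problem = Summit), so the duplicated namespace component is intended.
set_option linter.dupNamespace false

namespace Summit.ValiantsHypothesis.ValiantsHypothesis.Theorems.DivisionGap.PerCofactorDegreeReduction.TwoTowerCollapse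

open MvPolynomial Literature.Computability.AlgebraicComplexity
open scoped NNReal BigOperators

/-! ### §1 Real and imaginary parts of coefficients: descent of divisibility from `ℂ` to `ℝ` -/

section Descent

variable {σ : Type*}

/-- Coefficients of the coefficientwise image of a complex polynomial under an additive map
`ℓ : ℂ → ℝ` (real part, imaginary part). [folklore] -/
theorem coeff_mapRange (ℓ : ℂ →+ ℝ) (p : MvPolynomial σ ℂ) (m : σ →₀ ℕ) :
    coeff m (AddMonoidAlgebra.map ℓ p : MvPolynomial σ ℝ) = ℓ (coeff m p) := rfl

/-- An `ℝ`-linear coefficient map `ℓ` commutes with multiplication by a REAL polynomial: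
`ℓ(q · s) = q · ℓ(s)`. [folklore] -/
theorem mapRange_map_mul (ℓ : ℂ →+ ℝ) (hℓ : ∀ (a : ℝ) (z : ℂ), ℓ (a * z) = a * ℓ z)
    (q : MvPolynomial σ ℝ) (s : MvPolynomial σ ℂ) :
    (AddMonoidAlgebra.map ℓ (map Complex.ofRealHom q * s) : MvPolynomial σ ℝ) =
      q * AddMonoidAlgebra.map ℓ s := by
  classical
  ext m
  simp only [coeff_mapRange, coeff_mul, map_sum, coeff_map, Complex.ofRealHom_eq_coe, hℓ]

/-- **Divisibility of real polynomials descends from `ℂ` to `ℝ`**: if `q ∣ r` in `ℂ[x]` for real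
`q, r`, then `q ∣ r` in `ℝ[x]` (the real part of the cofactor is a real cofactor). [folklore] -/
theorem dvd_of_map_ofRealHom_dvd {q r : MvPolynomial σ ℝ}
    (h : map Complex.ofRealHom q ∣ map Complex.ofRealHom r) : q ∣ r := by
  obtain ⟨s, hs⟩ := h
  refine ⟨AddMonoidAlgebra.map Complex.reAddGroupHom s, ?_⟩
  rw [← mapRange_map_mul _ (fun a z => by simp) q s, ← hs]
  ext m
  simp [coeff_map]

/-- **Imaginary parts**: if `q ∣ r - c · r'` in `ℂ[x]` for real `q, r, r'` and a NON-REAL constant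
`c`, then `q ∣ r'` in `ℝ[x]` (the imaginary part of `r - c r'` is `-(Im c) r'`). [folklore] -/
theorem dvd_of_map_dvd_sub_C_mul {q r r' : MvPolynomial σ ℝ} {c : ℂ} (hc : c.im ≠ 0)
    (h : map Complex.ofRealHom q ∣ map Complex.ofRealHom r - C c * map Complex.ofRealHom r') :
    q ∣ r' := by
  obtain ⟨s, hs⟩ := h
  have key := congr_arg
    (fun p => (AddMonoidAlgebra.map Complex.imAddGroupHom p : MvPolynomial σ ℝ)) hs
  rw [mapRange_map_mul _ (fun a z => by simp) q s] at key
  have him : (AddMonoidAlgebra.map Complex.imAddGroupHom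
      (map Complex.ofRealHom r - C c * map Complex.ofRealHom r') : MvPolynomial σ ℝ) =
      -(c.im • r') := by
    ext m
    simp [coeff_map]
  refine ⟨(-(c.im)⁻¹) • AddMonoidAlgebra.map Complex.imAddGroupHom s, ?_⟩
  rw [mul_smul_comm, ← key, him, smul_neg, neg_smul, neg_neg, smul_smul, inv_mul_cancel₀ hc,
    one_smul]

/-- Descent for the permanent: `per_n ∣ r` over `ℂ` implies `per_n ∣ r` over `ℝ`, for a real
polynomial `r`. [folklore] -/
theorem per_descent {n : ℕ} {r : MvPolynomial (Fin n × Fin n) ℝ}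
    (h : perPoly (Fin n) ℂ ∣ map Complex.ofRealHom r) : perPoly (Fin n) ℝ ∣ r :=
  dvd_of_map_ofRealHom_dvd (by rwa [map_perPoly])

/-- Ascent for the permanent: `per_n ∣ r` over `ℝ` implies `per_n ∣ r` over `ℂ`. [folklore] -/
theorem per_ascent {n : ℕ} {r : MvPolynomial (Fin n × Fin n) ℝ} (h : perPoly (Fin n) ℝ ∣ r) :
    perPoly (Fin n) ℂ ∣ map Complex.ofRealHom r := by
  simpa only [map_perPoly] using map_dvd (MvPolynomial.map Complex.ofRealHom) h

end Descent

/-! ### §2 Graded domains: units, prime multiplicities of homogeneous elements, two towers -/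

section Graded

open DirectSum SetLike UniqueFactorizationMonoid Literature.RingTheory.RegularLocalRing

variable {A : Type*} [CommRing A] [IsDomain A] (𝒜 : ℕ → AddSubgroup A) [GradedRing 𝒜]

/-- **Units of an `ℕ`-graded domain are homogeneous of degree `0`**: from `x y = 1 ∈ A₀`, both
`x` and `y` are homogeneous (divisors of a nonzero homogeneous element) and their degrees add up
to `0`. [folklore] -/
theorem mem_zero_of_isUnit {x : A} (hx : IsUnit x) : x ∈ 𝒜 0 := by
  obtain ⟨y, hxy⟩ := hx.exists_right_inv
  have h1 : x * y ∈ 𝒜 0 := by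
    rw [hxy]
    exact SetLike.one_mem_graded 𝒜
  have h0 : x * y ≠ 0 := by
    rw [hxy]
    exact one_ne_zero
  obtain ⟨i, hi⟩ := isHomogeneousElem_of_mul_mem 𝒜 h1 h0
  obtain ⟨j, hj⟩ := isHomogeneousElem_of_mul_mem 𝒜 (x := y) (y := x) (d := 0)
    (by rwa [mul_comm]) (by rwa [mul_comm])
  have hij : x * y ∈ 𝒜 (i + j) := SetLike.mul_mem_graded hi hj
  have h := DirectSum.degree_eq_of_mem_mem 𝒜 h1 hij h0
  have hi0 : i = 0 := by omega
  rwa [hi0] at hi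

/-- **Prime powers dividing a homogeneous element.** If `A₀` consists of units (and `0`), `π` is
prime and `π^k` divides a nonzero homogeneous `x` of degree `d`, then `k ≤ d`: `π` and the
cofactor are homogeneous, `deg π ≥ 1` as `π` is not a unit, and `k · deg π + deg(cofactor) = d`.
[folklore] -/
theorem le_of_prime_pow_dvd (h0 : ∀ a ∈ 𝒜 0, a ≠ 0 → IsUnit a) {p x : A} (hp : Prime p)
    {d k : ℕ} (hx : x ∈ 𝒜 d) (hx0 : x ≠ 0) (hk : p ^ k ∣ x) : k ≤ d := by
  obtain ⟨y, hy⟩ := hk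
  rcases Nat.eq_zero_or_pos k with rfl | hkpos
  · exact Nat.zero_le _
  have hpk0 : p ^ k * y ≠ 0 := hy ▸ hx0
  have hpky : p ^ k * y ∈ 𝒜 d := hy ▸ hx
  have hsplit : p * (p ^ (k - 1) * y) = p ^ k * y := by
    rw [← mul_assoc, ← pow_succ', Nat.sub_add_cancel hkpos]
  obtain ⟨e, he⟩ := isHomogeneousElem_of_mul_mem 𝒜 (x := p) (y := p ^ (k - 1) * y) (d := d)
    (by rwa [hsplit]) (by rwa [hsplit])
  obtain ⟨f, hf⟩ := isHomogeneousElem_of_mul_mem 𝒜 (x := y) (y := p ^ k) (d := d)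
    (by rwa [mul_comm]) (by rwa [mul_comm])
  have hprod : p ^ k * y ∈ 𝒜 (k • e + f) :=
    SetLike.mul_mem_graded (SetLike.pow_mem_graded k he) hf
  have hdeg : d = k • e + f := DirectSum.degree_eq_of_mem_mem 𝒜 hpky hprod hpk0
  have he0 : e ≠ 0 := by
    rintro rfl
    exact hp.not_unit (h0 p he hp.ne_zero)
  rw [smul_eq_mul] at hdeg
  calc k ≤ k * e := Nat.le_mul_of_pos_right k (Nat.pos_of_ne_zero he0)
    _ ≤ d := by omega

/-- In a unique factorisation monoid, `q ^ (count of q among the normalised prime factors of x)`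
divides `x` (`x ≠ 0`). [folklore] -/
theorem pow_count_normalizedFactors_dvd {α : Type*} [CommMonoidWithZero α]
    [NormalizationMonoid α] [UniqueFactorizationMonoid α] [DecidableEq α] {x : α} (hx : x ≠ 0)
    (q : α) : q ^ (normalizedFactors x).count q ∣ x := by
  have hle : Multiset.replicate ((normalizedFactors x).count q) q ≤ normalizedFactors x :=
    Multiset.le_count_iff_replicate_le.mp le_rfl
  have h := Multiset.prod_dvd_prod_of_le hle
  rw [Multiset.prod_replicate] at h
  exact h.trans (prod_normalizedFactors hx).dvd

/-- **Multiplicity bound**: in a graded UFD with `A₀` a field, every normalised prime factor of a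
nonzero homogeneous element of degree `d` occurs with multiplicity `≤ d`. [folklore] -/
theorem count_normalizedFactors_le [UniqueFactorizationMonoid A] [NormalizationMonoid A]
    [DecidableEq A] (h0 : ∀ a ∈ 𝒜 0, a ≠ 0 → IsUnit a) {x : A} {d : ℕ} (hx : x ∈ 𝒜 d)
    (hx0 : x ≠ 0) (q : A) : (normalizedFactors x).count q ≤ d := by
  by_cases hq : q ∈ normalizedFactors x
  · exact le_of_prime_pow_dvd 𝒜 h0 (prime_of_normalized_factor q hq) hx hx0
      (pow_count_normalizedFactors_dvd hx0 q)
  · rw [Multiset.count_eq_zero_of_notMem hq]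
    exact Nat.zero_le _

/-- Arithmetic of the tower comparison: `a + N x = b + N y` with `a, b < N` forces `x = y`.
[folklore] -/
theorem eq_of_add_mul_eq {a b x y d₁ d₂ N : ℕ} (h₁ : d₁ < N) (h₂ : d₂ < N) (ha : a ≤ d₁)
    (hb : b ≤ d₂) (h : a + N * x = b + N * y) : x = y := by
  have hx : N * x < N * (y + 1) := by rw [mul_add_one]; omega
  have hy : N * y < N * (x + 1) := by rw [mul_add_one]; omega
  have hx' := lt_of_mul_lt_mul_left hx (Nat.zero_le _)
  have hy' := lt_of_mul_lt_mul_left hy (Nat.zero_le _)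
  omega

/-- **Two towers in a graded UFD.** Let `A` be an `ℕ`-graded UFD with `A₀` a field, `Vᵢ ≠ 0`
homogeneous of degree `dᵢ < N`, `u, u' ≠ 0`, and `V₁ u^N + V₂ u'^N = 0`.  Then `u` and `u'` are
associated: for every prime `π`, `v_π(V₁) + N v_π(u) = v_π(V₂) + N v_π(u')` with
`v_π(Vᵢ) ≤ dᵢ < N` forces `v_π(u) = v_π(u')`. [folklore] -/
theorem associated_of_twoTower [UniqueFactorizationMonoid A] (h0 : ∀ a ∈ 𝒜 0, a ≠ 0 → IsUnit a)
    {V₁ V₂ u u' : A} {d₁ d₂ N : ℕ} (hV₁ : V₁ ∈ 𝒜 d₁) (hV₂ : V₂ ∈ 𝒜 d₂) (hV₁0 : V₁ ≠ 0)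
    (hV₂0 : V₂ ≠ 0) (hu : u ≠ 0) (hu' : u' ≠ 0) (h₁ : d₁ < N) (h₂ : d₂ < N)
    (hrel : V₁ * u ^ N + V₂ * u' ^ N = 0) : Associated u u' := by
  classical
  letI : NormalizationMonoid A :=
    (UniqueFactorizationMonoid.strongNormalizationMonoid (α := A)).toNormalizationMonoid
  have hassoc : Associated (V₁ * u ^ N) (V₂ * u' ^ N) := by
    rw [eq_neg_of_add_eq_zero_left hrel]
    exact (Associated.refl _).neg_left
  have hnf := hassoc.normalizedFactors_eq
  rw [normalizedFactors_mul hV₁0 (pow_ne_zero _ hu), normalizedFactors_mul hV₂0 (pow_ne_zero _ hu'),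
    normalizedFactors_pow, normalizedFactors_pow] at hnf
  rw [associated_iff_normalizedFactors_eq_normalizedFactors hu hu', Multiset.ext]
  intro q
  have hc := congr_arg (Multiset.count q) hnf
  simp only [Multiset.count_add, Multiset.count_nsmul] at hc
  exact eq_of_add_mul_eq h₁ h₂ (count_normalizedFactors_le 𝒜 h0 hV₁ hV₁0 q)
    (count_normalizedFactors_le 𝒜 h0 hV₂ hV₂0 q) hc

/-- **Two towers, for a grading by submodules** (the form of the quotient grading): under the
hypotheses of `associated_of_twoTower`, `u = ε u'` for a unit `ε` of degree `0`.  The grading by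
submodules is re-bundled as the same grading by additive subgroups. [folklore] -/
theorem exists_unit_of_twoTower {R B : Type*} [CommRing R] [CommRing B] [Algebra R B] [IsDomain B]
    [UniqueFactorizationMonoid B] (ℬ : ℕ → Submodule R B) [GradedAlgebra ℬ]
    (h0 : ∀ a ∈ ℬ 0, a ≠ 0 → IsUnit a) {V₁ V₂ u u' : B} {d₁ d₂ N : ℕ}
    (hV₁ : V₁ ∈ ℬ d₁) (hV₂ : V₂ ∈ ℬ d₂) (hV₁0 : V₁ ≠ 0) (hV₂0 : V₂ ≠ 0) (hu : u ≠ 0)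
    (hu' : u' ≠ 0) (h₁ : d₁ < N) (h₂ : d₂ < N) (hrel : V₁ * u ^ N + V₂ * u' ^ N = 0) :
    ∃ ε ∈ ℬ 0, IsUnit ε ∧ u = ε * u' := by
  classical
  -- the same grading, by additive subgroups
  let 𝒜 : ℕ → AddSubgroup B := fun i => (ℬ i).toAddSubgroup
  letI : GradedRing 𝒜 :=
    { one_mem := (SetLike.GradedOne.one_mem : (1 : B) ∈ ℬ 0)
      mul_mem := fun _ _ _ _ ha hb => SetLike.GradedMul.mul_mem (A := ℬ) ha hb
      decompose' := DirectSum.decompose ℬ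
      left_inv := (DirectSum.decompose ℬ).left_inv
      right_inv := (DirectSum.decompose ℬ).right_inv }
  have h0' : ∀ a ∈ 𝒜 0, a ≠ 0 → IsUnit a := fun a ha => h0 a ha
  obtain ⟨ε, hε⟩ := (associated_of_twoTower 𝒜 h0' (d₁ := d₁) (d₂ := d₂) hV₁ hV₂ hV₁0 hV₂0 hu
    hu' h₁ h₂ hrel).symm
  refine ⟨(ε : B), ?_, ε.isUnit, ?_⟩
  · exact (mem_zero_of_isUnit 𝒜 ε.isUnit : (ε : B) ∈ 𝒜 0)
  · rw [← hε, mul_comm]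

end Graded

/-! ### §3 The theorem -/

/-- **stub_twoTowerCollapse — TWO-TOWER COLLAPSE modulo the permanent.**  For `n ≥ 3`, nonzero
homogeneous `V₁, V₂ ∈ ℝ≥0[x_ij]` of degrees `< N` and `per_n ∣ V₁ u^N + V₂ u'^N` over `ℝ`, one of:
`per_n ∣ u`, `per_n ∣ u'`, `per_n ∣ c V₁ + V₂` (`c > 0`), `per_n ∣ u + c u'` (`c > 0`), all over
`ℝ`.  Proof in the graded UFD `S_n = ℂ[x]/(per_n)`
(`Summit.ValiantsHypothesis.Theorems.permQuot_isDomain_and_ufm`): prime multiplicities of the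
homogeneous `V̄ᵢ` are `< N`, so `ū`, `ū'` have equal multiplicities at every prime and
`ū = c ū'` with `c` a unit, i.e. a nonzero constant, real by conjugation-free descent (imaginary
parts), and the sign of `c` selects the third (`c^N V₁ + V₂`) or fourth (`u + |c| u'`) disjunct;
`ū = 0`, `ū' = 0`, `V̄ᵢ = 0` are the degenerate disjuncts.  The hypotheses `Vᵢ ≠ 0` and the
homogeneity of `u`, `u'` are part of the registered signature but unused.
[abc-tower-collapse, First lemma] -/
theorem stub_twoTowerCollapse (n N : ℕ) (V₁ V₂ u u' : MvPolynomial (Fin n × Fin n) ℝ≥0)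
    (hn : 3 ≤ n) (hV₁ : V₁ ≠ 0) (hV₂ : V₂ ≠ 0)
    (hV₁h : V₁.IsHomogeneous V₁.totalDegree) (hV₂h : V₂.IsHomogeneous V₂.totalDegree)
    (huh : u.IsHomogeneous u.totalDegree) (hu'h : u'.IsHomogeneous u'.totalDegree)
    (hN₁ : V₁.totalDegree < N) (hN₂ : V₂.totalDegree < N)
    (hdvd : perPoly (Fin n) ℝ ∣ MvPolynomial.map NNReal.toRealHom (V₁ * u ^ N + V₂ * u' ^ N)) :
    perPoly (Fin n) ℝ ∣ MvPolynomial.map NNReal.toRealHom u ∨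
    perPoly (Fin n) ℝ ∣ MvPolynomial.map NNReal.toRealHom u' ∨
    (∃ c : ℝ≥0, 0 < c ∧ perPoly (Fin n) ℝ ∣ MvPolynomial.map NNReal.toRealHom (c • V₁ + V₂)) ∨
    (∃ c : ℝ≥0, 0 < c ∧ perPoly (Fin n) ℝ ∣ MvPolynomial.map NNReal.toRealHom (u + c • u')) := by
  classical
  -- `huh`, `hu'h`, `hV₁`, `hV₂` belong to the registered signature but are not needed
  have _ := huh; have _ := hu'h; have _ := hV₁; have _ := hV₂
  -- the first two disjuncts
  by_cases h1 : perPoly (Fin n) ℝ ∣ MvPolynomial.map NNReal.toRealHom u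
  · exact Or.inl h1
  by_cases h2 : perPoly (Fin n) ℝ ∣ MvPolynomial.map NNReal.toRealHom u'
  · exact Or.inr (Or.inl h2)
  refine Or.inr (Or.inr ?_)
  -- `S_n = ℂ[x]/(per_n)`: a domain and a UFD, graded by total degree, degree-0 part `ℂ`
  obtain ⟨hdom, hufm⟩ := Summit.ValiantsHypothesis.Theorems.permQuot_isDomain_and_ufm hn
  letI := MvPolynomial.gradedAlgebra (σ := Fin n × Fin n) (R := ℂ)
  have hhom : (Ideal.span {perPoly (Fin n) ℂ}).IsHomogeneous
      (homogeneousSubmodule (Fin n × Fin n) ℂ) :=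
    Ideal.homogeneous_span _ _ fun x hx => by
      rw [Set.mem_singleton_iff] at hx
      subst hx
      exact ⟨_, (mem_homogeneousSubmodule _ _).2 perPoly_isHomogeneous⟩
  letI : GradedAlgebra (Literature.RingTheory.GradedAlgebra.quotGrading
      (homogeneousSubmodule (Fin n × Fin n) ℂ) (Ideal.span {perPoly (Fin n) ℂ})) :=
    Literature.RingTheory.GradedAlgebra.quotGrading.gradedAlgebra
      (homogeneousSubmodule (Fin n × Fin n) ℂ) ⟨Ideal.span {perPoly (Fin n) ℂ}, hhom⟩
  have h0 : ∀ a ∈ Literature.RingTheory.GradedAlgebra.quotGrading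
      (homogeneousSubmodule (Fin n × Fin n) ℂ) (Ideal.span {perPoly (Fin n) ℂ}) 0,
      a ≠ 0 → IsUnit a := by
    intro a ha ha0
    obtain ⟨c, hc, rfl⟩ := Literature.RingTheory.GradedAlgebra.mem_quotGrading_iff.1 ha
    rw [mem_homogeneousSubmodule] at hc
    have hcC : c = C (coeff 0 c) :=
      totalDegree_eq_zero_iff_eq_C.mp ((totalDegree_zero_iff_isHomogeneous _).mpr hc)
    have hr : coeff 0 c ≠ 0 := fun h => ha0 (by rw [hcC, h, C_0, map_zero])
    rw [hcC]
    exact ((isUnit_iff_ne_zero.mpr hr).map C).map _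
  -- the reduction map `Φ : ℝ≥0[x] → ℝ[x] → ℂ[x] → S_n`
  obtain ⟨Φ, hΦdef⟩ : ∃ Φ : MvPolynomial (Fin n × Fin n) ℝ≥0 →+*
      MvPolynomial (Fin n × Fin n) ℂ ⧸ Ideal.span {perPoly (Fin n) ℂ},
      Φ = (Ideal.Quotient.mk (Ideal.span {perPoly (Fin n) ℂ})).comp
        ((MvPolynomial.map Complex.ofRealHom).comp (MvPolynomial.map NNReal.toRealHom)) :=
    ⟨_, rfl⟩
  have hΦ : ∀ p, Φ p = Ideal.Quotient.mk (Ideal.span {perPoly (Fin n) ℂ})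
      (MvPolynomial.map Complex.ofRealHom (MvPolynomial.map NNReal.toRealHom p)) := fun p => by
    rw [hΦdef]; rfl
  have hΦ0 : ∀ p, Φ p = 0 ↔ perPoly (Fin n) ℂ ∣
      MvPolynomial.map Complex.ofRealHom (MvPolynomial.map NNReal.toRealHom p) := fun p => by
    rw [hΦ, Ideal.Quotient.eq_zero_iff_mem, Ideal.mem_span_singleton]
  have hΦC : ∀ (b : ℝ≥0) (p : MvPolynomial (Fin n × Fin n) ℝ≥0),
      Φ (b • p) = Ideal.Quotient.mk (Ideal.span {perPoly (Fin n) ℂ}) (C ((b : ℝ) : ℂ)) * Φ p := by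
    intro b p
    simp only [hΦ, smul_eq_C_mul, map_mul, MvPolynomial.map_C]
    rfl
  -- the two-tower relation in `S_n`, and the non-vanishing of `ū`, `ū'`, `V̄₁`, `V̄₂`
  have hrel : Φ V₁ * Φ u ^ N + Φ V₂ * Φ u' ^ N = 0 := by
    rw [← map_pow, ← map_pow, ← map_mul, ← map_mul, ← map_add, hΦ0]
    exact per_ascent hdvd
  have hu0 : Φ u ≠ 0 := fun h => h1 (per_descent ((hΦ0 u).1 h))
  have hu'0 : Φ u' ≠ 0 := fun h => h2 (per_descent ((hΦ0 u').1 h))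
  by_cases hV₁0 : Φ V₁ = 0
  · -- degenerate: `V̄₁ = 0`, hence `V̄₂ = 0`; third disjunct with `c = 1`
    have hV₂0 : Φ V₂ = 0 := by
      rw [hV₁0, zero_mul, zero_add] at hrel
      exact (mul_eq_zero.1 hrel).resolve_right (pow_ne_zero _ hu'0)
    refine Or.inl ⟨1, one_pos, per_descent ((hΦ0 _).1 ?_)⟩
    rw [one_smul, map_add, hV₁0, hV₂0, add_zero]
  have hV₂0 : Φ V₂ ≠ 0 := fun hV₂0 => by
    rw [hV₂0, zero_mul, add_zero] at hrel
    exact hV₁0 ((mul_eq_zero.1 hrel).resolve_right (pow_ne_zero _ hu0))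
  -- `V̄ᵢ` is homogeneous of degree `deg Vᵢ`
  have hmem : ∀ V : MvPolynomial (Fin n × Fin n) ℝ≥0, V.IsHomogeneous V.totalDegree →
      Φ V ∈ Literature.RingTheory.GradedAlgebra.quotGrading
        (homogeneousSubmodule (Fin n × Fin n) ℂ) (Ideal.span {perPoly (Fin n) ℂ}) V.totalDegree :=
    fun V hV => by
      rw [hΦ]
      exact Literature.RingTheory.GradedAlgebra.mk_mem_quotGrading
        ((mem_homogeneousSubmodule _ _).2 ((hV.map _).map _))
  -- the core: `ū = ε ū'` with `ε` a unit of degree `0`, the class of a constant `c`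
  obtain ⟨ε, hε0, hεu, hε⟩ := exists_unit_of_twoTower _ h0 (hmem V₁ hV₁h) (hmem V₂ hV₂h) hV₁0
    hV₂0 hu0 hu'0 hN₁ hN₂ hrel
  obtain ⟨a, ha, hεa⟩ := Literature.RingTheory.GradedAlgebra.mem_quotGrading_iff.1 hε0
  rw [mem_homogeneousSubmodule] at ha
  obtain ⟨c, rfl⟩ : ∃ c : ℂ, a = C c :=
    ⟨coeff 0 a, totalDegree_eq_zero_iff_eq_C.mp ((totalDegree_zero_iff_isHomogeneous _).mpr ha)⟩
  -- `per_n ∣ u - c u'` over `ℂ`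
  have hdiv : perPoly (Fin n) ℂ ∣
      MvPolynomial.map Complex.ofRealHom (MvPolynomial.map NNReal.toRealHom u) -
        C c * MvPolynomial.map Complex.ofRealHom (MvPolynomial.map NNReal.toRealHom u') := by
    rw [← Ideal.mem_span_singleton, ← Ideal.Quotient.eq_zero_iff_mem, map_sub, map_mul, ← hΦ,
      ← hΦ, hεa, hε, sub_self]
  -- `c` is real: otherwise `per_n ∣ u'`
  have hcim : c.im = 0 := by
    by_contra hcim
    exact h2 (dvd_of_map_dvd_sub_C_mul (r := MvPolynomial.map NNReal.toRealHom u) hcim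
      (by rwa [map_perPoly]))
  have hc : c = ((c.re : ℝ) : ℂ) := Complex.ext (by simp) (by simp [hcim])
  -- `c ≠ 0`
  have hre0 : c.re ≠ 0 := by
    intro hre0
    apply hεu.ne_zero
    rw [← hεa, hc, hre0, Complex.ofReal_zero, C_0, map_zero]
  rcases lt_or_gt_of_ne hre0 with hneg | hpos
  · -- `c < 0`: `ū + |c| ū' = 0`, fourth disjunct
    obtain ⟨b, hb0, hb⟩ : ∃ b : ℝ≥0, 0 < b ∧ ((b : ℝ) : ℂ) = -c :=
      ⟨NNReal.mk (-c.re) (by linarith), NNReal.coe_pos.1 (show (0 : ℝ) < -c.re by linarith), by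
        rw [NNReal.coe_mk, Complex.ofReal_neg, ← hc]⟩
    refine Or.inr ⟨b, hb0, per_descent ((hΦ0 _).1 ?_)⟩
    rw [map_add, hΦC, hb, hε, ← hεa, ← add_mul, ← map_add, ← map_add, add_neg_cancel, map_zero,
      map_zero, zero_mul]
  · -- `c > 0`: `(c^N V̄₁ + V̄₂) ū'^N = 0`, so `c^N V̄₁ + V̄₂ = 0`, third disjunct
    have hkey : Φ V₁ * ε ^ N + Φ V₂ = 0 := by
      rw [hε, mul_pow, ← mul_assoc, ← add_mul] at hrel
      exact (mul_eq_zero.1 hrel).resolve_right (pow_ne_zero _ hu'0)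
    obtain ⟨b, hb0, hb⟩ : ∃ b : ℝ≥0, 0 < b ∧ ((b : ℝ) : ℂ) = c ^ N :=
      ⟨NNReal.mk (c.re ^ N) (pow_pos hpos N).le,
        NNReal.coe_pos.1 (show (0 : ℝ) < c.re ^ N from pow_pos hpos N), by
        rw [NNReal.coe_mk, Complex.ofReal_pow, ← hc]⟩
    refine Or.inl ⟨b, hb0, per_descent ((hΦ0 _).1 ?_)⟩
    rw [map_add, hΦC, hb, C_pow, map_pow, hεa, mul_comm (ε ^ N) (Φ V₁)]
    exact hkey

end Summit.ValiantsHypothesis.ValiantsHypothesis.Theorems.DivisionGap.PerCofactorDegreeReduction.TwoTowerCollapse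

end
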